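import Summits.QuantumFields.YangMills.Theorems.BalabanUVNodesN11NoExpansionOldBranchIntegrable
import Summits.QuantumFields.YangMills.Theorems.BalabanUVNodesN11RePinnedParamDefs
import Literature.MathematicalPhysics.QuantumFieldTheory.Balaban1983to89.B16RLeafRecord13LiveGenericZS
import Literature.MathematicalPhysics.QuantumFieldTheory.Balaban1983to89.Node00.Record13CoreAtTheta13LiveOfRecord

/-!
# DAG node N11 — THE NO-EXPANSION STEP AFTER AN ARBITRARY HISTORY AT THE RE-PINNED v1.7 PARAMETER `rePinH θ`, READ THROUGH 𝐑, INTEGRABLE FORM: the post-𝐑 §2 dichotomy of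
# `ρ_{k+1}`'s slot at every no-expansion `s′` from the clause ∕ §2 form of `ρ_k` there and, PER WITNESS, the old action's fluctuation-locality `hA` and the old-branch rows
# measurability `hmB` ∕ INTEGRABILITY `hIB` — NO residual-slot binder, NO sup bound (the NON-DEGENERATE edition of this seat's `…RePinnedPostRCoPH` §1–§2 old-branch faces)

Cell `pub-ymgap`, YM-PLAN Track A (HUMAN RULING D-0062), seat `pub-ymgap-dag-n11-e` (g13; R134 fan-out row N11∕s3), route `BalabanUVNodes` rev 25 (v1.7 `CoPH` key), item K1⁷
`StabilityBAtRecordR13SepCoPH` = stmt-QuantumFields-20542 (helper lane, count-neutral).  [III] = [Balaban1988Convergent], [IV] = [Balaban1989LargeFieldI].  Over dag-n11-d's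
`…N11NoExpansionOldBranchIntegrable` (p563293: p547524's old-branch step with the sup bound `hCB` RE-TYPED to integrability `hIB` against the one-step law), `…N11RePinnedParamDefs`
(p552185), this seat's `…LiveGenericZS` §0 (p539943) and `Node00.Record13CoreAtTheta13LiveOfRecord` (p562464).

WHY THIS FILE.  Referee ref-I READ-281 (NIT-A2, kernel-checked probe `oldBranch_eq_zero_of_hCB`) exhibited that the `SLaw`-keyed old-branch faces carrying ONE constant `{C}`
uniform over every witness `(t₀, E₀)` — dag-n11-d's p547524 `exists_…_of_sLaw₁₃CoPH_of_oldBranch` and, «the same shape», this seat's re-pinned editions p555408 §1–§2 (and the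
law-level p555972) — are inhabited only in the zero-branch world: the operand scales like `e^{−E₀}`, so a bound uniform in `E₀ ∈ ℝ` forces the old branch to vanish.  The cure is
the currency dag-n11-d had already typed: INTEGRABILITY of the old branch PER WITNESS (`…OldBranchIntegrable`), no constant at all.  This file states the re-pinned post-𝐑 faces in
that currency (binders (P) `hpre` ∕ (V) `hZ` ∕ `hq` ∕ `hqloc` discharged by `prefix_agree_rePinH` ∕ `zhAt_rePinH_ζ0_univ_pairCfgAt` ∕ `rfl`; 𝐑-side this seat's
`slotClauseΦ_succ_of_slotTClauseΦ_of_liveSel_of_rstep`).  HENCE: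
§1 (generic `θ`, at `rePinH θ`) `slotClause_succ_rePinH_of_Omega_empty_of_integrable_of_clause_of_liveSel` (clause-keyed) · ★★
   `exists_slotClause_succ_rePinH_of_Omega_empty_of_sLaw₁₃CoPH_of_integrable_of_liveSel` (keyed on `SLaw₁₃CoPH (rePinH θ) p k`; `hA`, `hmB`, `hIB` per witness).
§2 ★★ `exists_slotClause_succ_rePinH_door_ofCured_of_Omega_empty_of_integrable_of_liveSel` (re-pinned door of K0a's cured family, `θ₀.Provisos₁₃Core` + selector clause) · ★★
   `exists_slotClause_succ_rePinH_door_theta13LiveOfRecord_of_Omega_empty_of_integrable` (door of the cured witness of record: core conjunct, selector, `rstep`, `M = 1` ALL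
   DISCHARGED — only `k < K`, `SLaw` at level `k`, and per witness `hA`, `hmB`, `hIB` remain).

HONEST FRAMING.  Count-neutral kernel bookkeeping (one application each of dag-n11-d's R4b faces at the NAMED term `rePinH θ` + this seat's 𝐑-transfer); `hA` (inhabited along
all-`Ω`-empty old terms), `hmB` (= operand measurability at `rePinH θ`: a `Sect2.TermValues` measurability law, not in the tree) and `hIB` stay DISPLAYED per witness; the
sequences with `Ω_{k+1}(s′) ≠ ∅` are [III] Sect. 1 ∕ §3 ∕ Thm 2 proper; the zero branch is not excluded; the certificate family is NOT H3's value of record; nothing of Bałaban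
asserted; N11 NOT discharged; K1⁷ NOT closed; counts unmoved (typed 28∕28 · discharged 5∕27).  One finite `𝕋⁴_{L^K}` programme at fixed `ε = L^{−K}`; NOT ℝ⁴, NOT OS, NOT a
mass gap, NOT Clay.
Sources: [III] Thm 1 p.262, Theorem p.245, (2.17)–(2.18) p.257, (2.20)–(2.25) pp.258–259, (3.1) p.264, (3.16)–(3.22) pp.268–269, (3.24)–(3.25) p.270, (1.11) p.248; [IV] (0.2)–(0.4)
p.176, p.177 (i)–(ii).
-/

noncomputable section

open MeasureTheory
open scoped BigOperators Matrix.Norms.L2Operator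

namespace Summit.QuantumFields.YangMills.Theorems.BalabanUVNodesN11NoExpansionGeneralStepRePinnedIntegrableCoPH

open Literature.MathematicalPhysics.QuantumFieldTheory.Balaban1983to89 T4Continuum Node00 Node00.Tk DagBinding
open Literature.MathematicalPhysics.QuantumFieldTheory.Balaban1983to89.B16RLeafRecord13LiveGenericZS
open BalabanUVNodesN11RePinnedParamDefs (rePinH provisos₁₃CoPH_rePinH prefix_agree_rePinH zhAt_rePinH_ζ0_univ_pairCfgAt)
open BalabanUVNodesN11NoExpansionOldBranchIntegrable (clause_succ_CoPH_of_Omega_empty_of_pinChi_of_oldBranch_of_clause_of_integrable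
  exists_clause_succ_CoPH_of_Omega_empty_of_sLaw₁₃CoPH_of_oldBranch_of_integrable)

variable {F : T4Family} {N : ℕ} [NeZero N]

/-! ## §1. Generic `θ : Stage13HParams`, at `rePinH θ`, on the live-selector line — old-branch rows measurability ∕ integrability -/

section RePinned

variable (θ : Stage13HParams F N) (p : B12.RunParams)

/-- **THE NO-EXPANSION STEP AFTER ANY HISTORY AT `rePinH θ`, READ THROUGH 𝐑, OLD-BRANCH INTEGRABLE FORM — clause-keyed.**  dag-n11-d's integrable old-branch step
(`…OldBranchIntegrable.clause_succ_CoPH_of_Omega_empty_of_pinChi_of_oldBranch_of_clause_of_integrable`) at `θ := rePinH θ` with (P) `hpre`, (V) `hZ`, `hq`, `hqloc` discharged by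
`…RePinnedParamDefs`, then this seat's Φ-generic 𝐑-transfer on the live-selector line: from the level-`k` clause `hid` at `init s′` (re-pinned weights), `hA`, and the old-branch
rows measurability `hmB` ∕ INTEGRABILITY `hIB` (no sup bound), the post-𝐑 §2 dichotomy of `ρ_{k+1}`'s slot at `s′`.
[cite: Balaban1988Convergent, Thm 1 p.262, Theorem p.245, (3.24)–(3.25) p.270, (2.18) p.257, (2.20)–(2.25) pp.258–259, (3.1) p.264, (3.16) p.268; Balaban1989LargeFieldI, (0.2)–(0.4) p.176, p.177 (i)–(ii)] -/
theorem slotClause_succ_rePinH_of_Omega_empty_of_integrable_of_clause_of_liveSel (h : θ.Provisos₁₃CoPH F N)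
    (hsel : θ.ppSel = ppSelLiveOfRecord F N θ.ν θ.τ9 (EOfRecord₁₃ F N θ.toStage13Params) (wOfRecord₉ F N θ.toStage9Params))
    {k : ℕ} (hk : k < p.K) (hM : 1 ≤ θ.τ9.M)
    (s : SeqOfRecord F θ.ν θ.τ9.M (gOfRecord₁₃ F N θ.toStage13Params p) p.K (k + 1)) (hΩ : s.Ω (k + 1) = ∅)
    (t : Sect2.TermValues (F.P p.K) (MatA N) (FluctV N) θ.τ9.M) (E₀ : ℝ)
    (hA : ∀ (S : ℕ → Set (Site (F.P p.K) 0)) (a a' : Tk.MSFluct (F.P p.K) (FluctV N)) (Uf : GaugeField (F.P p.K) 0 (SU N)), (∀ i, i ≤ k → a i = a' i) →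
      (sect2ActionDataOfRecord F N (FluctV N) p.K (settingOfRecord₁₃ F N θ.toStage13Params p) (θ.rzAt p s.init) s.init t (S, a) E₀).action23 k Uf =
        (sect2ActionDataOfRecord F N (FluctV N) p.K (settingOfRecord₁₃ F N θ.toStage13Params p) (θ.rzAt p s.init) s.init t (S, a') E₀).action23 k Uf)
    (hid : slotsOfRecord F N θ.ν θ.τ9 (EOfRecord₁₃ F N θ.toStage13Params) (wOfRecord₉ F N θ.toStage9Params) θ.ppSel p
        (gOfRecord₁₃ F N θ.toStage13Params p) k s.init = 0 ∨
      ∀ᵐ U₀ ∂fieldMeasure (F.P p.K) k (SU N),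
        chiSeqOfRecord F N θ.ν θ.τ9.M (gOfRecord₁₃ F N θ.toStage13Params p) p.K k s.init U₀ ≠ 0 →
          slotsOfRecord F N θ.ν θ.τ9 (EOfRecord₁₃ F N θ.toStage13Params) (wOfRecord₉ F N θ.toStage9Params) θ.ppSel p
              (gOfRecord₁₃ F N θ.toStage13Params p) k s.init U₀ =
            sect2Slot F N (FluctV N) p.K (settingOfRecord₁₃ F N θ.toStage13Params p) (θ.rzAt p s.init) (WtOfRecord₁₃H F N (rePinH θ) p s.init) s.init t E₀
              (UbgOfRecord₁₃CoP F N θ.toStage13Params p k s.init) U₀)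
    (hmB : ∀ S ∈ admSOfRecord F θ.ν θ.τ9.M (gOfRecord₁₃ F N θ.toStage13Params p) p.K k s.init,
      Measurable fun U₀ : GaugeField (F.P p.K) k (SU N) =>
        tkBranchOfRecord F N (FluctV N) θ.ν θ.τ9.M _ p.K (WtOfRecord₁₃H F N (rePinH θ) p s) s.init S k
          (fun ω => sect2Operand F N (FluctV N) p.K (settingOfRecord₁₃ F N θ.toStage13Params p) (θ.rzAt p s.init) s.init t E₀
            (UbgOfRecord₁₃CoP F N θ.toStage13Params p k s.init) (S, fun j => (ω j).2) (fun j => (ω j).1))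
          (baseCfg (V := FluctV N) k U₀))
    (hIB : ∀ S ∈ admSOfRecord F θ.ν θ.τ9.M (gOfRecord₁₃ F N θ.toStage13Params p) p.K k s.init,
      Integrable (fun U₀ : GaugeField (F.P p.K) k (SU N) =>
        tkBranchOfRecord F N (FluctV N) θ.ν θ.τ9.M _ p.K (WtOfRecord₁₃H F N (rePinH θ) p s) s.init S k
          (fun ω => sect2Operand F N (FluctV N) p.K (settingOfRecord₁₃ F N θ.toStage13Params p) (θ.rzAt p s.init) s.init t E₀
            (UbgOfRecord₁₃CoP F N θ.toStage13Params p k s.init) (S, fun j => (ω j).2) (fun j => (ω j).1))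
          (baseCfg (V := FluctV N) k U₀)) (fieldMeasure (F.P p.K) k (SU N))) :
    slotsOfRecord F N θ.ν θ.τ9 (EOfRecord₁₃ F N θ.toStage13Params) (wOfRecord₉ F N θ.toStage9Params) θ.ppSel p
        (gOfRecord₁₃ F N θ.toStage13Params p) (k + 1) s = 0 ∨
      ∀ᵐ V' ∂fieldMeasure (F.P p.K) (k + 1) (SU N),
        chiSeqOfRecord F N θ.ν θ.τ9.M (gOfRecord₁₃ F N θ.toStage13Params p) p.K (k + 1) s V' ≠ 0 →
          slotsOfRecord F N θ.ν θ.τ9 (EOfRecord₁₃ F N θ.toStage13Params) (wOfRecord₉ F N θ.toStage9Params) θ.ppSel p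
              (gOfRecord₁₃ F N θ.toStage13Params p) (k + 1) s V' =
            sect2Slot F N (FluctV N) p.K (settingOfRecord₁₃ F N θ.toStage13Params p) (θ.rzAt p s) (WtOfRecord₁₃H F N (rePinH θ) p s) s t E₀
              (UbgOfRecord₁₃CoP F N θ.toStage13Params p (k + 1) s) V' :=
  slotClauseΦ_succ_of_slotTClauseΦ_of_liveSel_of_rstep F N θ.toStage13Params p (fun q j _ hj => h.rstep q j hj) hsel k hk s _ fun _ =>
    clause_succ_CoPH_of_Omega_empty_of_pinChi_of_oldBranch_of_clause_of_integrable (rePinH θ) p (provisos₁₃CoPH_rePinH h) hk hM s hΩ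
      (fun _ _ _ _ _ => rfl) (prefix_agree_rePinH θ p s hΩ) t E₀ hA hid (zhAt_rePinH_ζ0_univ_pairCfgAt θ p hk s hΩ) (fun _ _ => rfl) hmB hIB


/-- **★★ THEOREM 1's INDUCTIVE STEP ON THE NO-EXPANSION BRANCH AFTER ANY HISTORY, READ THROUGH 𝐑, AT `rePinH θ`, INTEGRABLE FORM — keyed on `SLaw₁₃CoPH (rePinH θ) p k` ITSELF.**
From the §2 form of `ρ_k` in the re-pinned weights, the core provisos and live-selector clause at `θ`, `k < K`, `1 ≤ M`, and — at a new `s′` with `Ω_{k+1}(s′) = ∅` after ANY history —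
ONLY the analytic rows `hA`, `hmB`, `hIB`, each asked PER WITNESS `(t₀, E₀)` (no constant uniform in `(t₀, E₀)`: dag-n11-d's `exists_clause_succ_CoPH_of_Omega_empty_of_sLaw₁₃CoPH_of_oldBranch_of_integrable`):
THERE ARE term values and a constant with the §2 dichotomy of `ρ_{k+1}`'s post-𝐑 slot at `s′`.  This is the NON-DEGENERATE edition of p555408's `…_of_sLaw₁₃CoPH_of_oldBranch_of_liveSel`
(whose `{C}`-uniform `hCB` is inhabited only in the zero-branch world — referee ref-I READ-281 NIT-A2). [cite: Balaban1988Convergent, Thm 1 p.262, Theorem p.245, (3.24)–(3.25) p.270, (2.17)–(2.18) p.257, (2.20)–(2.25) pp.258–259, (3.1) p.264, (3.16)–(3.20) pp.268–269, (1.11) p.248; Balaban1989LargeFieldI, (0.2)–(0.4) p.176, p.177 (i)–(ii)] -/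
theorem exists_slotClause_succ_rePinH_of_Omega_empty_of_sLaw₁₃CoPH_of_integrable_of_liveSel (h : θ.Provisos₁₃CoPH F N)
    (hsel : θ.ppSel = ppSelLiveOfRecord F N θ.ν θ.τ9 (EOfRecord₁₃ F N θ.toStage13Params) (wOfRecord₉ F N θ.toStage9Params))
    {k : ℕ} (hk : k < p.K) (hM : 1 ≤ θ.τ9.M) (hS : SLaw₁₃CoPH F N (rePinH θ) p k)
    (s : SeqOfRecord F θ.ν θ.τ9.M (gOfRecord₁₃ F N θ.toStage13Params p) p.K (k + 1)) (hΩ : s.Ω (k + 1) = ∅)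
    (hA : ∀ (t₀ : Sect2.TermValues (F.P p.K) (MatA N) (FluctV N) θ.τ9.M) (E₀ : ℝ) (S : ℕ → Set (Site (F.P p.K) 0))
      (a a' : Tk.MSFluct (F.P p.K) (FluctV N)) (Uf : GaugeField (F.P p.K) 0 (SU N)), (∀ i, i ≤ k → a i = a' i) →
      (sect2ActionDataOfRecord F N (FluctV N) p.K (settingOfRecord₁₃ F N θ.toStage13Params p) (θ.rzAt p s.init) s.init t₀ (S, a) E₀).action23 k Uf =
        (sect2ActionDataOfRecord F N (FluctV N) p.K (settingOfRecord₁₃ F N θ.toStage13Params p) (θ.rzAt p s.init) s.init t₀ (S, a') E₀).action23 k Uf)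
    (hmB : ∀ (t₀ : Sect2.TermValues (F.P p.K) (MatA N) (FluctV N) θ.τ9.M) (E₀ : ℝ),
      ∀ S ∈ admSOfRecord F θ.ν θ.τ9.M (gOfRecord₁₃ F N θ.toStage13Params p) p.K k s.init,
      Measurable fun U₀ : GaugeField (F.P p.K) k (SU N) =>
        tkBranchOfRecord F N (FluctV N) θ.ν θ.τ9.M _ p.K (WtOfRecord₁₃H F N (rePinH θ) p s) s.init S k
          (fun ω => sect2Operand F N (FluctV N) p.K (settingOfRecord₁₃ F N θ.toStage13Params p) (θ.rzAt p s.init) s.init t₀ E₀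
            (UbgOfRecord₁₃CoP F N θ.toStage13Params p k s.init) (S, fun j => (ω j).2) (fun j => (ω j).1))
          (baseCfg (V := FluctV N) k U₀))
    (hIB : ∀ (t₀ : Sect2.TermValues (F.P p.K) (MatA N) (FluctV N) θ.τ9.M) (E₀ : ℝ),
      ∀ S ∈ admSOfRecord F θ.ν θ.τ9.M (gOfRecord₁₃ F N θ.toStage13Params p) p.K k s.init,
      Integrable (fun U₀ : GaugeField (F.P p.K) k (SU N) =>
        tkBranchOfRecord F N (FluctV N) θ.ν θ.τ9.M _ p.K (WtOfRecord₁₃H F N (rePinH θ) p s) s.init S k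
          (fun ω => sect2Operand F N (FluctV N) p.K (settingOfRecord₁₃ F N θ.toStage13Params p) (θ.rzAt p s.init) s.init t₀ E₀
            (UbgOfRecord₁₃CoP F N θ.toStage13Params p k s.init) (S, fun j => (ω j).2) (fun j => (ω j).1))
          (baseCfg (V := FluctV N) k U₀)) (fieldMeasure (F.P p.K) k (SU N))) :
    ∃ (t₀ : Sect2.TermValues (F.P p.K) (MatA N) (FluctV N) θ.τ9.M) (E' : ℝ),
      slotsOfRecord F N θ.ν θ.τ9 (EOfRecord₁₃ F N θ.toStage13Params) (wOfRecord₉ F N θ.toStage9Params) θ.ppSel p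
          (gOfRecord₁₃ F N θ.toStage13Params p) (k + 1) s = 0 ∨
        ∀ᵐ V' ∂fieldMeasure (F.P p.K) (k + 1) (SU N),
          chiSeqOfRecord F N θ.ν θ.τ9.M (gOfRecord₁₃ F N θ.toStage13Params p) p.K (k + 1) s V' ≠ 0 →
            slotsOfRecord F N θ.ν θ.τ9 (EOfRecord₁₃ F N θ.toStage13Params) (wOfRecord₉ F N θ.toStage9Params) θ.ppSel p
                (gOfRecord₁₃ F N θ.toStage13Params p) (k + 1) s V' =
              sect2Slot F N (FluctV N) p.K (settingOfRecord₁₃ F N θ.toStage13Params p) (θ.rzAt p s) (WtOfRecord₁₃H F N (rePinH θ) p s) s t₀ E'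
                (UbgOfRecord₁₃CoP F N θ.toStage13Params p (k + 1) s) V' := by
  obtain ⟨t₀, E', hT⟩ := exists_clause_succ_CoPH_of_Omega_empty_of_sLaw₁₃CoPH_of_oldBranch_of_integrable (rePinH θ) p (provisos₁₃CoPH_rePinH h) hk hM hS s hΩ
    (fun _ _ _ _ _ => rfl) (prefix_agree_rePinH θ p s hΩ) hA (zhAt_rePinH_ζ0_univ_pairCfgAt θ p hk s hΩ) (fun _ _ => rfl) hmB hIB
  exact ⟨t₀, E', slotClauseΦ_succ_of_slotTClauseΦ_of_liveSel_of_rstep F N θ.toStage13Params p (fun q j _ hj => h.rstep q j hj) hsel k hk s _ fun _ => hT⟩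


end RePinned

/-! ## §2. At the re-pinned door of node00-def-K0a's cured family and of the cured witness of record -/

section Door

variable (θ₀ : Stage13Params F N) (p : B12.RunParams)

/-- **★★ THE GENERAL-HISTORY NO-EXPANSION STEP, READ THROUGH 𝐑, AT THE RE-PINNED DOOR `rePinH (ofHistoryBlind (ofCured θ₀))` OF K0a's CURED FAMILY, INTEGRABLE FORM, EVERY
NO-EXPANSION HISTORY**: from `θ₀.Provisos₁₃Core`, node00-def-T's live-selector clause of `θ₀`, `SLaw₁₃CoPH` at the re-pinned door at level `k`, `k < K`, `1 ≤ M`, and per witness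
`(t₀, E₀)` the rows `hA`, `hmB`, `hIB` ONLY. [cite: Balaban1988Convergent, Thm 1 p.262, Theorem p.245, (3.24)–(3.25) p.270, (2.18) p.257, (2.20)–(2.25) pp.258–259, (3.1) p.264, (3.16)–(3.20) pp.268–269, (1.11) p.248; Balaban1989LargeFieldI, (0.3)–(0.4) p.176, p.177 (i)–(ii)] -/
theorem exists_slotClause_succ_rePinH_door_ofCured_of_Omega_empty_of_integrable_of_liveSel (h : θ₀.Provisos₁₃Core F N)
    (hsel : θ₀.ppSel = ppSelLiveOfRecord F N θ₀.ν θ₀.τ9 (EOfRecord₁₃ F N θ₀) (wOfRecord₉ F N θ₀.toStage9Params))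
    {k : ℕ} (hk : k < p.K) (hM : 1 ≤ θ₀.τ9.M)
    (hS : SLaw₁₃CoPH F N (rePinH (Stage13HParams.ofHistoryBlind F N (Stage13RParams.ofCured F N θ₀))) p k)
    (s : SeqOfRecord F θ₀.ν θ₀.τ9.M (gOfRecord₁₃ F N θ₀ p) p.K (k + 1)) (hΩ : s.Ω (k + 1) = ∅)
    (hA : ∀ (t₀ : Sect2.TermValues (F.P p.K) (MatA N) (FluctV N) θ₀.τ9.M) (E₀ : ℝ) (S : ℕ → Set (Site (F.P p.K) 0))
      (a a' : Tk.MSFluct (F.P p.K) (FluctV N)) (Uf : GaugeField (F.P p.K) 0 (SU N)), (∀ i, i ≤ k → a i = a' i) →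
      (sect2ActionDataOfRecord F N (FluctV N) p.K (settingOfRecord₁₃ F N θ₀ p) (θ₀.Rz p.K) s.init t₀ (S, a) E₀).action23 k Uf =
        (sect2ActionDataOfRecord F N (FluctV N) p.K (settingOfRecord₁₃ F N θ₀ p) (θ₀.Rz p.K) s.init t₀ (S, a') E₀).action23 k Uf)
    (hmB : ∀ (t₀ : Sect2.TermValues (F.P p.K) (MatA N) (FluctV N) θ₀.τ9.M) (E₀ : ℝ),
      ∀ S ∈ admSOfRecord F θ₀.ν θ₀.τ9.M (gOfRecord₁₃ F N θ₀ p) p.K k s.init,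
      Measurable fun U₀ : GaugeField (F.P p.K) k (SU N) =>
        tkBranchOfRecord F N (FluctV N) θ₀.ν θ₀.τ9.M _ p.K
          (WtOfRecord₁₃H F N (rePinH (Stage13HParams.ofHistoryBlind F N (Stage13RParams.ofCured F N θ₀))) p s) s.init S k
          (fun ω => sect2Operand F N (FluctV N) p.K (settingOfRecord₁₃ F N θ₀ p) (θ₀.Rz p.K) s.init t₀ E₀
            (UbgOfRecord₁₃CoP F N θ₀ p k s.init) (S, fun j => (ω j).2) (fun j => (ω j).1))
          (baseCfg (V := FluctV N) k U₀))
    (hIB : ∀ (t₀ : Sect2.TermValues (F.P p.K) (MatA N) (FluctV N) θ₀.τ9.M) (E₀ : ℝ),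
      ∀ S ∈ admSOfRecord F θ₀.ν θ₀.τ9.M (gOfRecord₁₃ F N θ₀ p) p.K k s.init,
      Integrable (fun U₀ : GaugeField (F.P p.K) k (SU N) =>
        tkBranchOfRecord F N (FluctV N) θ₀.ν θ₀.τ9.M _ p.K
          (WtOfRecord₁₃H F N (rePinH (Stage13HParams.ofHistoryBlind F N (Stage13RParams.ofCured F N θ₀))) p s) s.init S k
          (fun ω => sect2Operand F N (FluctV N) p.K (settingOfRecord₁₃ F N θ₀ p) (θ₀.Rz p.K) s.init t₀ E₀
            (UbgOfRecord₁₃CoP F N θ₀ p k s.init) (S, fun j => (ω j).2) (fun j => (ω j).1))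
          (baseCfg (V := FluctV N) k U₀)) (fieldMeasure (F.P p.K) k (SU N))) :
    ∃ (t₀ : Sect2.TermValues (F.P p.K) (MatA N) (FluctV N) θ₀.τ9.M) (E' : ℝ),
      slotsOfRecord F N θ₀.ν θ₀.τ9 (EOfRecord₁₃ F N θ₀) (wOfRecord₉ F N θ₀.toStage9Params) θ₀.ppSel p (gOfRecord₁₃ F N θ₀ p) (k + 1) s = 0 ∨
        ∀ᵐ V' ∂fieldMeasure (F.P p.K) (k + 1) (SU N),
          chiSeqOfRecord F N θ₀.ν θ₀.τ9.M (gOfRecord₁₃ F N θ₀ p) p.K (k + 1) s V' ≠ 0 →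
            slotsOfRecord F N θ₀.ν θ₀.τ9 (EOfRecord₁₃ F N θ₀) (wOfRecord₉ F N θ₀.toStage9Params) θ₀.ppSel p (gOfRecord₁₃ F N θ₀ p) (k + 1) s V' =
              sect2Slot F N (FluctV N) p.K (settingOfRecord₁₃ F N θ₀ p) (θ₀.Rz p.K)
                (WtOfRecord₁₃H F N (rePinH (Stage13HParams.ofHistoryBlind F N (Stage13RParams.ofCured F N θ₀))) p s) s t₀ E'
                (UbgOfRecord₁₃CoP F N θ₀ p (k + 1) s) V' := by
  obtain ⟨t₀, E', hT⟩ := exists_clause_succ_CoPH_of_Omega_empty_of_sLaw₁₃CoPH_of_oldBranch_of_integrable (rePinH (Stage13HParams.ofHistoryBlind F N (Stage13RParams.ofCured F N θ₀))) p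
    (provisos₁₃CoPH_rePinH h.ofCured.ofHistoryBlind) hk hM hS s hΩ (fun _ _ _ _ _ => rfl) (prefix_agree_rePinH (Stage13HParams.ofHistoryBlind F N (Stage13RParams.ofCured F N θ₀)) p s hΩ) hA
    (zhAt_rePinH_ζ0_univ_pairCfgAt (Stage13HParams.ofHistoryBlind F N (Stage13RParams.ofCured F N θ₀)) p hk s hΩ) (fun _ _ => rfl) hmB hIB
  exact ⟨t₀, E', slotClauseΦ_succ_of_slotTClauseΦ_of_liveSel_of_rstep F N θ₀ p (fun q j _ hj => h.rstep q j hj) hsel k hk s _ fun _ => hT⟩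


end Door

section DoorRecord

variable (F N)
variable (p : B12.RunParams)

/-- **★★ … AT THE RE-PINNED DOOR OF THE CURED WITNESS OF RECORD, INTEGRABLE FORM — the K0-class core conjunct, the selector clause, row `rstep` and `M = 1` ALL DISCHARGED**
(this seat's `Node00.provisos₁₃CoPH_door_theta13LiveOfRecord`, K0a's `liveRepin₁₃_liveSel` inside `slotClauseΦ_succ_of_slotTClauseΦ_theta13LiveOfRecord`, the family's numerals):
from `k < K`, `SLaw₁₃CoPH` at the re-pinned door at level `k`, and per witness `hA`, `hmB`, `hIB` ONLY. [cite: Balaban1988Convergent, Thm 1 p.262, Theorem p.245, (3.24)–(3.25) p.270, (1.11) p.248, (3.1) p.264, (3.16)–(3.22) pp.268–269; Balaban1989LargeFieldI, (0.3)–(0.4) p.176, p.177 (i)–(ii)] -/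
theorem exists_slotClause_succ_rePinH_door_theta13LiveOfRecord_of_Omega_empty_of_integrable {k : ℕ} (hk : k < p.K)
    (hS : SLaw₁₃CoPH F N (rePinH (Stage13HParams.ofHistoryBlind F N (Stage13RParams.ofCured F N (theta13LiveOfRecord F N)))) p k)
    (s : SeqOfRecord F (theta13LiveOfRecord F N).ν (theta13LiveOfRecord F N).τ9.M (gOfRecord₁₃ F N (theta13LiveOfRecord F N) p) p.K (k + 1))
    (hΩ : s.Ω (k + 1) = ∅)
    (hA : ∀ (t₀ : Sect2.TermValues (F.P p.K) (MatA N) (FluctV N) (theta13LiveOfRecord F N).τ9.M) (E₀ : ℝ) (S : ℕ → Set (Site (F.P p.K) 0))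
      (a a' : Tk.MSFluct (F.P p.K) (FluctV N)) (Uf : GaugeField (F.P p.K) 0 (SU N)), (∀ i, i ≤ k → a i = a' i) →
      (sect2ActionDataOfRecord F N (FluctV N) p.K (settingOfRecord₁₃ F N (theta13LiveOfRecord F N) p) ((theta13LiveOfRecord F N).Rz p.K) s.init t₀ (S, a) E₀).action23 k Uf =
        (sect2ActionDataOfRecord F N (FluctV N) p.K (settingOfRecord₁₃ F N (theta13LiveOfRecord F N) p) ((theta13LiveOfRecord F N).Rz p.K) s.init t₀ (S, a') E₀).action23 k Uf)
    (hmB : ∀ (t₀ : Sect2.TermValues (F.P p.K) (MatA N) (FluctV N) (theta13LiveOfRecord F N).τ9.M) (E₀ : ℝ),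
      ∀ S ∈ admSOfRecord F (theta13LiveOfRecord F N).ν (theta13LiveOfRecord F N).τ9.M (gOfRecord₁₃ F N (theta13LiveOfRecord F N) p) p.K k s.init,
      Measurable fun U₀ : GaugeField (F.P p.K) k (SU N) =>
        tkBranchOfRecord F N (FluctV N) (theta13LiveOfRecord F N).ν (theta13LiveOfRecord F N).τ9.M _ p.K
          (WtOfRecord₁₃H F N (rePinH (Stage13HParams.ofHistoryBlind F N (Stage13RParams.ofCured F N (theta13LiveOfRecord F N)))) p s) s.init S k
          (fun ω => sect2Operand F N (FluctV N) p.K (settingOfRecord₁₃ F N (theta13LiveOfRecord F N) p) ((theta13LiveOfRecord F N).Rz p.K) s.init t₀ E₀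
            (UbgOfRecord₁₃CoP F N (theta13LiveOfRecord F N) p k s.init) (S, fun j => (ω j).2) (fun j => (ω j).1))
          (baseCfg (V := FluctV N) k U₀))
    (hIB : ∀ (t₀ : Sect2.TermValues (F.P p.K) (MatA N) (FluctV N) (theta13LiveOfRecord F N).τ9.M) (E₀ : ℝ),
      ∀ S ∈ admSOfRecord F (theta13LiveOfRecord F N).ν (theta13LiveOfRecord F N).τ9.M (gOfRecord₁₃ F N (theta13LiveOfRecord F N) p) p.K k s.init,
      Integrable (fun U₀ : GaugeField (F.P p.K) k (SU N) =>
        tkBranchOfRecord F N (FluctV N) (theta13LiveOfRecord F N).ν (theta13LiveOfRecord F N).τ9.M _ p.K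
          (WtOfRecord₁₃H F N (rePinH (Stage13HParams.ofHistoryBlind F N (Stage13RParams.ofCured F N (theta13LiveOfRecord F N)))) p s) s.init S k
          (fun ω => sect2Operand F N (FluctV N) p.K (settingOfRecord₁₃ F N (theta13LiveOfRecord F N) p) ((theta13LiveOfRecord F N).Rz p.K) s.init t₀ E₀
            (UbgOfRecord₁₃CoP F N (theta13LiveOfRecord F N) p k s.init) (S, fun j => (ω j).2) (fun j => (ω j).1))
          (baseCfg (V := FluctV N) k U₀)) (fieldMeasure (F.P p.K) k (SU N))) :
    ∃ (t₀ : Sect2.TermValues (F.P p.K) (MatA N) (FluctV N) (theta13LiveOfRecord F N).τ9.M) (E' : ℝ),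
      slotsOfRecord F N (theta13LiveOfRecord F N).ν (theta13LiveOfRecord F N).τ9 (EOfRecord₁₃ F N (theta13LiveOfRecord F N))
          (wOfRecord₉ F N (theta13LiveOfRecord F N).toStage9Params) (theta13LiveOfRecord F N).ppSel p (gOfRecord₁₃ F N (theta13LiveOfRecord F N) p) (k + 1) s = 0 ∨
        ∀ᵐ V' ∂fieldMeasure (F.P p.K) (k + 1) (SU N),
          chiSeqOfRecord F N (theta13LiveOfRecord F N).ν (theta13LiveOfRecord F N).τ9.M (gOfRecord₁₃ F N (theta13LiveOfRecord F N) p) p.K (k + 1) s V' ≠ 0 →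
            slotsOfRecord F N (theta13LiveOfRecord F N).ν (theta13LiveOfRecord F N).τ9 (EOfRecord₁₃ F N (theta13LiveOfRecord F N))
                (wOfRecord₉ F N (theta13LiveOfRecord F N).toStage9Params) (theta13LiveOfRecord F N).ppSel p (gOfRecord₁₃ F N (theta13LiveOfRecord F N) p) (k + 1) s V' =
              sect2Slot F N (FluctV N) p.K (settingOfRecord₁₃ F N (theta13LiveOfRecord F N) p) ((theta13LiveOfRecord F N).Rz p.K)
                (WtOfRecord₁₃H F N (rePinH (Stage13HParams.ofHistoryBlind F N (Stage13RParams.ofCured F N (theta13LiveOfRecord F N)))) p s) s t₀ E'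
                (UbgOfRecord₁₃CoP F N (theta13LiveOfRecord F N) p (k + 1) s) V' := by
  obtain ⟨t₀, E', hT⟩ := exists_clause_succ_CoPH_of_Omega_empty_of_sLaw₁₃CoPH_of_oldBranch_of_integrable (rePinH (Stage13HParams.ofHistoryBlind F N (Stage13RParams.ofCured F N (theta13LiveOfRecord F N)))) p
    (provisos₁₃CoPH_rePinH (provisos₁₃CoPH_door_theta13LiveOfRecord F N)) hk (le_of_eq rfl) hS s hΩ (fun _ _ _ _ _ => rfl) (prefix_agree_rePinH (Stage13HParams.ofHistoryBlind F N (Stage13RParams.ofCured F N (theta13LiveOfRecord F N))) p s hΩ) hA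
    (zhAt_rePinH_ζ0_univ_pairCfgAt (Stage13HParams.ofHistoryBlind F N (Stage13RParams.ofCured F N (theta13LiveOfRecord F N))) p hk s hΩ) (fun _ _ => rfl) hmB hIB
  exact ⟨t₀, E', slotClauseΦ_succ_of_slotTClauseΦ_theta13LiveOfRecord F N p k hk s _ fun _ => hT⟩


end DoorRecord

end Summit.QuantumFields.YangMills.Theorems.BalabanUVNodesN11NoExpansionGeneralStepRePinnedIntegrableCoPH

end
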